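import Summits.BirchSwinnertonDyer.BirchSwinnertonDyer.Theorems.QuadraticBranchSignedControlPlusEtaNonsurjUnitRows
import Summits.BirchSwinnertonDyer.BirchSwinnertonDyer.Theorems.QuadraticBranchSignedControlPlusEtaNonsurjMuBound
import Summits.BirchSwinnertonDyer.Rank1Residual.O6.X4CongruenceAnchor
import HarnessLib

/-!
# Route `QuadraticBranchSignedControl` (rung K8, cell `bsd-potss`), residual crux `PlusEtaMainConjectureNonsurj`
# (stmt-BirchSwinnertonDyer-19606): the CM-UNIT-ANCHOR TRANSFER ROAD — Kobayashi's even main conjecture at `η` for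
# `(V, p)` on EVERY row congruent mod `p` to the twist of a CM unit anchor, of ANY rank and ANY shape of `L_p⁺`, from
# ONE displayed transfer frame (the body of the OPEN binder `CorpuzLei2025_etaPlusMainConjecture_transfer_OPEN`,
# Corpuz–Lei arXiv:2508.09733 Thms 1–3 at `i = (p−1)/2`, PREPRINT) + modularity + GZK + Burungale–Flach
# (a `--supports` file; seat `bsd-potss-k8eta-c2` g8)

WHAT. Crux 19606 is (C1⁺_η) — `X⁺(V/K_∞)^η` f.g. torsion and `Char = (L_p⁺(V,η,X))` — on the good supersingular
`a_p = 0` twists `V` (`p ≥ 5`) whose `p`-adic tower is NOT onto. On its NON-CM rows (`Im ρ̄_{V,p} = C_ns⁺(p)`) the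
cell's roads so far reach (C1⁺_η) per row through Coates–Sujatha (A) on the additive partner + the analytic `μ = 0`
(fine road, k8eta-c2 g6/g7), or through a PRIME `L_p⁺` (g4), each time modulo Kobayashi Thm. 2.2/4.1, Hatley–Lei,
Poitou–Tate, Kitajima–Otsuki and per-row analytic inputs; and the Eisenstein stub `stub_etaMC_nonCM_lower` keeps OPEN
content in-table on the rank ≥ 1 rows with non-prime `L_p⁺` (242325g1, 404325g1; rank 2: 162675m1, 242325h1). THIS
FILE is the Greenberg–Vatsal road at `η`: main conjectures TRANSFER along mod-`p` congruences when `μ = 0`. The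
transfer at a non-ordinary prime on the `ω^{(p−1)/2}`-component is Corpuz–Lei's 2025 PREPRINT (Thms 1 + 2 + 3:
analytic `μ`, algebraic `μ`, and the signed IMC transfer) — typed by this seat as the OPEN binder
`CorpuzLei2025_etaPlusMainConjecture_transfer_OPEN` (file `…PlusEtaNonsurjCorpuzLeiTransferOPEN.lean`, proposal
p552245, review-queued); HERE its BODY is the displayed hypothesis `hCL`, so this file does not depend on that
proposal. The ANCHOR side is a THEOREM of the tree: at the twist `V′` of a CM curve `A` with `L(A,1) ≠ 0`,
`v_p(#Ш(A)_an) ≤ 0`, `p ∤ Tam(A)` (a CM UNIT ANCHOR), (C1⁺_η)(V′,p) holds (`EtaUnitRows.quadraticBranchPlusEtaMainConjectureAt_of_hasCM_of_shaAn_unit`,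
modulo modularity `hmod`, GZK `hGZK`, Burungale–Flach bsd.S28 `hS28`; no Iwasawa-theoretic input) and
`μ(X⁺(V′/K_∞)^η) = 0` (`EtaMuBound.eta_hasUnitContent_of_selmer_trivial_of_not_dvd_tamagawa`, from `Sel_{p^∞}(A/ℚ) = 0`,
which §1 derives from the same three facts). HENCE (§2): for EVERY globally minimal `V`, good at `p` with `a_p(V) = 0`,
congruent mod `p` to `V′` (`ModPCongruent V′ V p`), (C1⁺_η)(V,p) — with NO hypothesis on the rank of the row, its
`L`-value, the shape of `L_p⁺(V,η,X)`, its analytic `μ`, and NO Kobayashi Thm. 2.2/4.1, Hatley–Lei, Poitou–Tate,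
Kitajima–Otsuki, (A), `L₀` or image condition. CENSUS (this seat, `work/kit/k8discover.py`, exact Fisher certificates;
table `pub/bsd-potss/k8eta-c2/g8/K8-CM-UNIT-ANCHORS-k8eta-c2-g8.tsv`): ALL 30 non-CM rows of the crux below `5·10⁵`
(`p = 5`; 12 rank 0, 16 rank 1, 2 rank 2) have a CM unit anchor in their mod-`5` class (`900b1`, `3600bb1`, `10800cj1`,
`11025e1`, `14400cz1`, or the unit siblings `[0,0,0,0,−675]`, `[0,0,1,0,−169]`, `[0,0,0,0,800]`, `[0,0,1,0,−405169]`) —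
the per-row records are the sibling files `…PlusEtaNonsurjCMAnchorTransferRecords*.lean`, whose congruence binder is
discharged from Fisher's Hesse families (`EtaModFiveCongruenceRecords`, p550581 + part C/D).

* §1 `selmerGroupPInfty_eq_bot_of_hasCM_unitAnchor` — `Sel_{p^∞}(A/ℚ) = 0` for a CM curve `A` with `L(A,1) ≠ 0` and
  `v_p(#Ш(A)_an) ≤ 0` (GZK: rank `0`, finiteness; bsd.S28: `BSD(A,p)`, so `ord_p #Ш(A) = v_p(#Ш_an) = 0`).
* §2 **`quadraticBranchPlusEtaMainConjectureAt_of_cmUnitAnchor_of_transferFrame`** — the road (displayed frame `hCL`).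
* §3 `etaMC_nonCM_anchoredRows_of_transferFrame` — the ∀-form on the crux's binders for rows GIVEN a CM unit anchor
  datum (for the planner: a v7 re-cut `stub_etaMC_nonCM_anchored` (this theorem, modulo the PRE binder) +
  `stub_etaMC_nonCM_unanchored` (the rest; class-wide OPEN) of the two non-CM primary stubs).

HONEST FRAMING (cell `bsd-potss`, run/shared/lean/pub/bsd-potss/; FULL-BSD rank ≤ 1 programme, HUMAN RULING
D-0036/D-0074): TOOL THEOREMS ONLY — no definition, no named fact minted here, no `sorry`, axioms standard. §2–§3 are
CONDITIONAL on the displayed frame `hCL` — the body of an OPEN binder transcribing an UNREFEREED preprint through a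
flagged dictionary (`CL25-eta-plus-dictionary`; refereed status: none) — and on modularity, GZK, bsd.S28 (named facts,
hypothesis position) and the displayed anchor data. The crux 19606 is NOT closed (CM rows; non-CM rows without a CM
unit anchor class-wide; the binder is PRE); no stub is proved by name; nothing is booked; `BSD(W,p)` is claimed for no
pair; BSD is not proved by any of this. `--supports stmt-BirchSwinnertonDyer-19606`.

References: [CorpuzLei2025] Thms 1–3 (= 5.3, 5.9, 5.10), Conj. 5.6, Prop. 5.8 (claim; hypothesis only);
[GreenbergVatsal2000] Thm. (1.4) (the ordinary prototype); [Kobayashi2003] §4 Even main conjecture (p. 8), Thm. 7.4;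
[BurungaleFlach2024] Thm. 1.1, Cor. 2; [GreenbergLNM1716] §3 Prop. 3.8, §4; [HatleyLei2019] Thm. 4.6.
-/

set_option autoImplicit false
set_option linter.dupNamespace false

noncomputable section

open scoped Classical

open CongruenceSubgroup Field Function NumberField IsDedekindDomain WeierstrassCurve
open Literature.NumberTheory.EllipticCurves
open Literature.NumberTheory.EllipticCurves.ModularForms
open Literature.NumberTheory.EllipticCurves.Rank1Residual
open Literature.NumberTheory.EllipticCurves.Rank1Residual.Typed
open Literature.NumberTheory.GaloisRepresentations
open Literature.NumberTheory.GaloisCohomology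
open Literature.NumberTheory.EllipticCurves.IwasawaAlgebra
open Literature.NumberTheory.EllipticCurves.IwasawaDual ZpExtension
open Literature.NumberTheory.EllipticCurves.GreenbergVatsal2000
open Summit.BirchSwinnertonDyer.Rank1Residual.X11b.Levels
open Summit.BirchSwinnertonDyer.Rank1Residual.X11b
open Summit.BirchSwinnertonDyer.Rank1Residual.Additive
open Summit.BirchSwinnertonDyer.Rank1Residual.Additive.SignedTwist
open scoped ContRepresentation
open Summit.BirchSwinnertonDyer.Rank1Residual.AdditivePotMult
open Summit.BirchSwinnertonDyer.Rank1Residual.O6 (ModPCongruent)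

namespace Summit.BirchSwinnertonDyer.BirchSwinnertonDyer.Theorems

namespace EtaCMAnchorTransfer

/-! ## §1 The anchor side: `Sel_{p^∞}(A/ℚ) = 0` at a CM unit anchor -/

section Anchor

variable (A : WeierstrassCurve ℚ) [A.IsElliptic] [A.IsGloballyMinimal] (p : ℕ) [hp : Fact p.Prime]

/-- **`Sel_{p^∞}(A/ℚ) = 0` at a CM unit anchor**: `A` CM with `L(A,1) ≠ 0` and `v_p(#Ш(A)_an) ≤ 0`. GZK gives rank `0`,
`A(ℚ)` and `Ш(A)` finite; Burungale–Flach's full BSD formula for the CM curve `A` (bsd.S28) gives Miller's `BSD(A,p)`, so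
`ord_p #Ш(A)[p^∞] = v_p(#Ш(A)_an) ≤ 0`; then `#Sel_{p^∞}(A/ℚ) = #Ш(A)[p^∞] = 1`
(`EtaUnitRows.selmerGroupPInfty_eq_bot_of_finite_of_padicValNat_card_sha`). Named facts: modularity, GZK, bsd.S28.
[cite: BurungaleFlach2024, Thm. 1.1 and Cor. 2] [cite: GreenbergLNM1716, §1 p. 54 and §4 p. 103]
[cite: Miller2011LMS, §1 and Def. 1.1] -/
theorem selmerGroupPInfty_eq_bot_of_hasCM_unitAnchor (hGZK : rank_eq_analyticRank_of_analyticRank_le_one)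
    (hS28 : bsdTriple_of_hasCM_of_L_one_ne_zero) (hCM : A.HasCM) (hLA : A.entireLFunction 1 ≠ 0)
    (hsha : ∃ s : ℚ, shaAn A = (s : ℂ) ∧ padicValRat p s ≤ 0) :
    A.selmerGroupPInfty p = ⊥ := by
  have hr0 : A.analyticRank = 0 := analyticRank_eq_zero_of_entireLFunction_one_ne_zero A hLA
  obtain ⟨hrank, hfin⟩ := hGZK A (by rw [hr0]; exact zero_le_one)
  haveI : Finite A.sha := hfin
  haveI : Finite A.toAffine.Point := A.finite_point_of_rank_zero (by rw [hrank, hr0])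
  have hT : A.BSDTriple := hS28 A hCM hLA
  obtain ⟨-, -, q, hq, hvq⟩ := forall_bsdp_of_bsdTriple' A hT p hp.out
  obtain ⟨s, hs, hvs⟩ := hsha
  have hqs : q = s := by exact_mod_cast hq.symm.trans hs
  have hsha0 : padicValNat p (Nat.card A.sha) = 0 := by
    rw [← padicValNat_card_addPrimaryComponent (A := A.sha) p]
    have h : (padicValNat p (Nat.card (AddCommGroup.primaryComponent A.sha p)) : ℤ) ≤ 0 := by
      rw [← hvq, hqs]; exact hvs
    omega
  exact EtaUnitRows.selmerGroupPInfty_eq_bot_of_finite_of_padicValNat_card_sha A p hsha0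

end Anchor

/-! ## §2 The road: (C1⁺_η) at a row congruent to the twist of a CM unit anchor, from the transfer frame -/

section Road

variable (p : ℕ) [hp : Fact p.Prime]

/-- **THE CM-UNIT-ANCHOR TRANSFER ROAD.** DATA: `p ≥ 5`; a CM curve `A/ℚ` (globally minimal) with `L(A,1) ≠ 0`,
`v_p(#Ш(A)_an) ≤ 0`, `p ∤ Tam(A)` (displayed); a globally minimal model `V′` of `A^{(p*)}` (`C′ • A.quadraticTwist (±p) = V′`)
good at `p` with `a_p(V′) = 0`; a globally minimal `V`, good at `p` with `a_p(V) = 0`, with `V′[p] ≃ V[p]`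
`Γ_ℚ`-equivariantly (`ModPCongruent V′ V p`). FRAME `hCL` (displayed; = the body of the OPEN binder
`CorpuzLei2025_etaPlusMainConjecture_transfer_OPEN`, Corpuz–Lei arXiv:2508.09733 Thms 1 + 2 + 3 at `i = (p−1)/2`, plus sign,
PREPRINT): for congruent good `a_p = 0` curves, (C1⁺_η) at the first WITH `μ = 0` implies (C1⁺_η) at the second. NAMED
FACTS: modularity `hmod`, GZK `hGZK`, Burungale–Flach bsd.S28 `hS28`. CONCLUSION: Kobayashi's even main conjecture at `η`
for `(V,p)`, `QuadraticBranchPlusEtaMainConjectureAt V p` — for a row of ANY rank and ANY `L_p⁺`-shape. PROOF: `V′` is CM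
(`j(V′) = j(A)`); (C1⁺_η)(V′,p) by `EtaUnitRows.quadraticBranchPlusEtaMainConjectureAt_of_hasCM_of_shaAn_unit`;
`μ(X⁺(V′/K_∞)^η) = 0` by `EtaMuBound.eta_hasUnitContent_of_selmer_trivial_of_not_dvd_tamagawa` with §1; feed the frame.
CONDITIONAL on `hCL` (PRE) and the named facts; nothing booked; no image / rank / `L`-value hypothesis on the row.
[claim: CorpuzLei2025, status: under-review] [cite: GreenbergVatsal2000, Thm. (1.4) (p. 2) — the ordinary prototype]
[cite: Kobayashi2003, §4 Even main conjecture (p. 8)] [cite: BurungaleFlach2024, Thm. 1.1 and Cor. 2]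
[cite: GreenbergLNM1716, §3 Prop. 3.8 (pp. 95–96)] -/
theorem quadraticBranchPlusEtaMainConjectureAt_of_cmUnitAnchor_of_transferFrame
    (hCL : ∀ (V V' : WeierstrassCurve ℚ) [V.IsElliptic] [V.IsGloballyMinimal] [V'.IsElliptic]
        [V'.IsGloballyMinimal] (p : ℕ) [Fact p.Prime],
        p ≠ 2 →
        V.HasGoodReductionAtPrime p → V.frobeniusTrace p = 0 →
        V'.HasGoodReductionAtPrime p → V'.frobeniusTrace p = 0 →
        (∃ e : geomTorsion V' (p : ℤ) ≃+ geomTorsion V (p : ℤ),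
          ∀ (σ : absoluteGaloisGroup ℚ) (P : geomTorsion V' (p : ℤ)), e (σ • P) = σ • e P) →
        QuadraticBranchPlusEtaMainConjectureAt V' p →
        (∀ (K₀ : Type) [Field K₀] [NumberField K₀] [IsCyclotomicExtension {p} ℚ K₀]
            [(galRange (K := ℚ) K₀).Normal] (ηq : absoluteGaloisGroup ℚ →* ℤˣ),
            (∀ σ ∈ galRange (K := ℚ) K₀, ηq σ = 1) → ηq ≠ 1 →
          ∀ (κ : ZpExtension ℚ p) (γ : absoluteGaloisGroup ℚ),
            κ.IsCyclotomic → κ.IsTopGenerator γ → γ ∈ galRange (K := ℚ) K₀ →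
          ∀ (D : EtaSignedSelmerDualData V' κ K₀ ℚ_[p] ηq γ 1) (g : IwasawaAlgebra p),
            D.charIdeal = Ideal.span {g} → HasUnitContent g) →
        QuadraticBranchPlusEtaMainConjectureAt V p)
    (hmod : hasEntireLFunction_rat) (hGZK : rank_eq_analyticRank_of_analyticRank_le_one)
    (hS28 : bsdTriple_of_hasCM_of_L_one_ne_zero) (hp5 : 5 ≤ p)
    (A : WeierstrassCurve ℚ) [A.IsElliptic] [A.IsGloballyMinimal] (hCM : A.HasCM)
    (hLA : A.entireLFunction 1 ≠ 0) (hsha : ∃ s : ℚ, shaAn A = (s : ℂ) ∧ padicValRat p s ≤ 0)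
    (htam : ¬ p ∣ A.tamagawaProduct)
    (V' : WeierstrassCurve ℚ) [V'.IsElliptic] [V'.IsGloballyMinimal] (C' : VariableChange ℚ)
    (hC'V' : C' • A.quadraticTwist ((-1) ^ (p / 2) * p) = V') (hgood' : V'.HasGoodReductionAtPrime p)
    (hap' : V'.frobeniusTrace p = 0)
    (V : WeierstrassCurve ℚ) [V.IsElliptic] [V.IsGloballyMinimal] (hgood : V.HasGoodReductionAtPrime p)
    (hap : V.frobeniusTrace p = 0) (hcong : ModPCongruent V' V p) :
    QuadraticBranchPlusEtaMainConjectureAt V p := by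
  have hp2 : p ≠ 2 := by omega
  -- `V′` is CM: `j(V′) = j(A^{(p*)}) = j(A)`
  have hd : ((-1 : ℚ) ^ (p / 2) * p) ≠ 0 :=
    mul_ne_zero (pow_ne_zero _ (neg_ne_zero.mpr one_ne_zero)) (Nat.cast_ne_zero.mpr hp.out.ne_zero)
  haveI := A.isElliptic_quadraticTwist hd
  have hj : V'.j = A.j := by subst hC'V'; rw [variableChange_j, j_quadraticTwist A hd]
  have hCM' : V'.HasCM := (hasCM_iff_of_j_eq hj).mpr hCM
  -- (C1⁺_η) at the anchor's twist, no Iwasawa input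
  have hMC' : QuadraticBranchPlusEtaMainConjectureAt V' p :=
    EtaUnitRows.quadraticBranchPlusEtaMainConjectureAt_of_hasCM_of_shaAn_unit A p hmod hGZK hS28 V' C' hp5 hC'V'
      hgood' hap' hCM' hLA hsha htam
  -- `μ = 0` at the anchor's twist
  have hSel : A.selmerGroupPInfty p = ⊥ :=
    selmerGroupPInfty_eq_bot_of_hasCM_unitAnchor A p hGZK hS28 hCM hLA hsha
  have hμ' := EtaMuBound.eta_hasUnitContent_of_selmer_trivial_of_not_dvd_tamagawa A p V' C' hp5 hC'V' hgood'
    hap' hSel htam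
  exact hCL V V' p hp2 hgood hap hgood' hap' hcong hMC' hμ'

/-- **The road for arbitrary models of the two twists** (the shape of the cell's records): `A`, `W` curves over `ℚ`
(the CM unit anchor and the row's additive partner), `V′` ANY globally minimal model of `A^{(p*)}` and `V` ANY globally
minimal model of `W^{(p*)}`, both good at `p` with `a_p = 0`, and the congruence supplied for these models by a function
`hcongVV` of the two model equations (the shape of `EtaModFiveCongruenceRecords.modPCongruent_twist5_*`). CONDITIONAL on
the frame `hCL` (PRE) + `hmod hGZK hS28`; nothing booked. [claim: CorpuzLei2025, status: under-review]
[cite: Kobayashi2003, §4 Even main conjecture (p. 8)] [cite: GreenbergVatsal2000, Thm. (1.4)] -/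
theorem quadraticBranchPlusEtaMainConjectureAt_models_of_cmUnitAnchor_of_transferFrame
    (hCL : ∀ (V V' : WeierstrassCurve ℚ) [V.IsElliptic] [V.IsGloballyMinimal] [V'.IsElliptic]
        [V'.IsGloballyMinimal] (p : ℕ) [Fact p.Prime],
        p ≠ 2 →
        V.HasGoodReductionAtPrime p → V.frobeniusTrace p = 0 →
        V'.HasGoodReductionAtPrime p → V'.frobeniusTrace p = 0 →
        (∃ e : geomTorsion V' (p : ℤ) ≃+ geomTorsion V (p : ℤ),
          ∀ (σ : absoluteGaloisGroup ℚ) (P : geomTorsion V' (p : ℤ)), e (σ • P) = σ • e P) →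
        QuadraticBranchPlusEtaMainConjectureAt V' p →
        (∀ (K₀ : Type) [Field K₀] [NumberField K₀] [IsCyclotomicExtension {p} ℚ K₀]
            [(galRange (K := ℚ) K₀).Normal] (ηq : absoluteGaloisGroup ℚ →* ℤˣ),
            (∀ σ ∈ galRange (K := ℚ) K₀, ηq σ = 1) → ηq ≠ 1 →
          ∀ (κ : ZpExtension ℚ p) (γ : absoluteGaloisGroup ℚ),
            κ.IsCyclotomic → κ.IsTopGenerator γ → γ ∈ galRange (K := ℚ) K₀ →
          ∀ (D : EtaSignedSelmerDualData V' κ K₀ ℚ_[p] ηq γ 1) (g : IwasawaAlgebra p),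
            D.charIdeal = Ideal.span {g} → HasUnitContent g) →
        QuadraticBranchPlusEtaMainConjectureAt V p)
    (hmod : hasEntireLFunction_rat) (hGZK : rank_eq_analyticRank_of_analyticRank_le_one)
    (hS28 : bsdTriple_of_hasCM_of_L_one_ne_zero) (hp5 : 5 ≤ p)
    (A : WeierstrassCurve ℚ) [A.IsElliptic] [A.IsGloballyMinimal] (hCM : A.HasCM)
    (hLA : A.entireLFunction 1 ≠ 0) (hsha : ∃ s : ℚ, shaAn A = (s : ℂ) ∧ padicValRat p s ≤ 0)
    (htam : ¬ p ∣ A.tamagawaProduct) (W : WeierstrassCurve ℚ)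
    (hcongVV : ∀ (V' V : WeierstrassCurve ℚ),
      (∃ C' : VariableChange ℚ, C' • A.quadraticTwist ((-1) ^ (p / 2) * p) = V') →
      (∃ C : VariableChange ℚ, C • W.quadraticTwist ((-1) ^ (p / 2) * p) = V) → ModPCongruent V' V p) :
    ∀ (V' : WeierstrassCurve ℚ) [V'.IsElliptic] [V'.IsGloballyMinimal]
      (V : WeierstrassCurve ℚ) [V.IsElliptic] [V.IsGloballyMinimal],
      (∃ C' : VariableChange ℚ, C' • A.quadraticTwist ((-1) ^ (p / 2) * p) = V') →
      V'.HasGoodReductionAtPrime p → V'.frobeniusTrace p = 0 →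
      (∃ C : VariableChange ℚ, C • W.quadraticTwist ((-1) ^ (p / 2) * p) = V) →
      V.HasGoodReductionAtPrime p → V.frobeniusTrace p = 0 →
      QuadraticBranchPlusEtaMainConjectureAt V p := by
  intro V' _ _ V _ _ hC' hgood' hap' hC hgood hap
  have hcong : ModPCongruent V' V p := hcongVV V' V hC' hC
  obtain ⟨C', hC'V'⟩ := hC'
  exact quadraticBranchPlusEtaMainConjectureAt_of_cmUnitAnchor_of_transferFrame p hCL hmod hGZK hS28 hp5 A hCM
    hLA hsha htam V' C' hC'V' hgood' hap' V hgood hap hcong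

end Road

/-! ## §3 The ∀-form on the crux's binders: the ANCHORED non-CM rows -/

/-- **19606 on its ANCHORED rows, modulo the transfer frame** — on the crux's binders (`p ≥ 5`, `V` good with
`a_p = 0`; the tower and CM binders are idle) GIVEN a CM unit anchor datum: a CM curve `A` (`L(A,1) ≠ 0`,
`v_p(#Ш(A)_an) ≤ 0`, `p ∤ Tam(A)`) and a good `a_p = 0` globally minimal model `V′` of `A^{(p*)}` congruent to `V` mod `p`.
The crux's conclusion `QuadraticBranchPlusEtaMainConjectureAt V p`, granted the frame `hCL` (PRE), modularity, GZK and
bsd.S28. For the planner: the TEXT of a v7 stub `stub_etaMC_nonCM_anchored` (closed modulo the PRE binder) whose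
complement `stub_etaMC_nonCM_unanchored` (non-CM rows with NO CM unit anchor in their mod-`p` class) carries the
class-wide OPEN content of `stub_etaMC_nonCM_upper` ∧ `stub_etaMC_nonCM_lower`; in-table (`N < 5·10⁵`, `p = 5`) the
unanchored set is EMPTY (census K8-CM-UNIT-ANCHORS-k8eta-c2-g8.tsv: 30/30 anchored). CONDITIONAL; no stub proved by name;
nothing booked. [claim: CorpuzLei2025, status: under-review] [cite: Kobayashi2003, §4 Even main conjecture (p. 8)]
[cite: GreenbergVatsal2000, Thm. (1.4)] [cite: BurungaleFlach2024, Thm. 1.1 and Cor. 2] -/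
theorem etaMC_anchoredRows_of_transferFrame
    (hCL : ∀ (V V' : WeierstrassCurve ℚ) [V.IsElliptic] [V.IsGloballyMinimal] [V'.IsElliptic]
        [V'.IsGloballyMinimal] (p : ℕ) [Fact p.Prime],
        p ≠ 2 →
        V.HasGoodReductionAtPrime p → V.frobeniusTrace p = 0 →
        V'.HasGoodReductionAtPrime p → V'.frobeniusTrace p = 0 →
        (∃ e : geomTorsion V' (p : ℤ) ≃+ geomTorsion V (p : ℤ),
          ∀ (σ : absoluteGaloisGroup ℚ) (P : geomTorsion V' (p : ℤ)), e (σ • P) = σ • e P) →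
        QuadraticBranchPlusEtaMainConjectureAt V' p →
        (∀ (K₀ : Type) [Field K₀] [NumberField K₀] [IsCyclotomicExtension {p} ℚ K₀]
            [(galRange (K := ℚ) K₀).Normal] (ηq : absoluteGaloisGroup ℚ →* ℤˣ),
            (∀ σ ∈ galRange (K := ℚ) K₀, ηq σ = 1) → ηq ≠ 1 →
          ∀ (κ : ZpExtension ℚ p) (γ : absoluteGaloisGroup ℚ),
            κ.IsCyclotomic → κ.IsTopGenerator γ → γ ∈ galRange (K := ℚ) K₀ →
          ∀ (D : EtaSignedSelmerDualData V' κ K₀ ℚ_[p] ηq γ 1) (g : IwasawaAlgebra p),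
            D.charIdeal = Ideal.span {g} → HasUnitContent g) →
        QuadraticBranchPlusEtaMainConjectureAt V p)
    (hmod : hasEntireLFunction_rat) (hGZK : rank_eq_analyticRank_of_analyticRank_le_one)
    (hS28 : bsdTriple_of_hasCM_of_L_one_ne_zero) :
    ∀ (V : WeierstrassCurve ℚ) [V.IsElliptic] [V.IsGloballyMinimal] (p : ℕ) [Fact p.Prime],
      5 ≤ p → V.HasGoodReductionAtPrime p → V.frobeniusTrace p = 0 →
      ¬ (∀ m : ℕ, V.HasSurjectiveModNGaloisRep (p ^ m : ℕ)) →
      ∀ (A : WeierstrassCurve ℚ) [A.IsElliptic] [A.IsGloballyMinimal]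
        (V' : WeierstrassCurve ℚ) [V'.IsElliptic] [V'.IsGloballyMinimal] (C' : VariableChange ℚ),
        A.HasCM → A.entireLFunction 1 ≠ 0 → (∃ s : ℚ, shaAn A = (s : ℂ) ∧ padicValRat p s ≤ 0) →
        ¬ p ∣ A.tamagawaProduct → C' • A.quadraticTwist ((-1) ^ (p / 2) * p) = V' →
        V'.HasGoodReductionAtPrime p → V'.frobeniusTrace p = 0 → ModPCongruent V' V p →
        QuadraticBranchPlusEtaMainConjectureAt V p := by
  intro V _ _ p _ hp5 hgood hap _ A _ _ V' _ _ C' hCM hLA hsha htam hC'V' hgood' hap' hcong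
  exact quadraticBranchPlusEtaMainConjectureAt_of_cmUnitAnchor_of_transferFrame p hCL hmod hGZK hS28 hp5 A hCM hLA
    hsha htam V' C' hC'V' hgood' hap' V hgood hap hcong

end EtaCMAnchorTransfer

end Summit.BirchSwinnertonDyer.BirchSwinnertonDyer.Theorems

end
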